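import Summits.HodgeConjecture.CorCM.IrreducibleOddWeightsCMTypes
import Summits.HodgeConjecture.CorCM.StabiliserOrbitSelfConjugateCMFields
import HarnessLib

/-!
# CM fields with irreducible odd weights: every CM type is nondegenerate and simple, families of types of the field are
# decided by EQUIVARIANT relations, and off (SC) more than `[K:ℚ]/4` pairwise non-isogenous varieties are exceptional

COR-CM (cell `pub-hodgecm2`, binder seat `b16` gen 55, count-neutral claim IRR-ODD, file F2 — the CM-field dress of F1
`CorCM/IrreducibleOddWeights` / F1b `CorCM/IrreducibleOddWeightsCMTypes`; theorems only, no definition, no named fact, no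
`sorry`).  NEW as stated, hence under `Summits/`.  HONEST FRAMING: statements about CM types of ONE CM field and about
products of abelian varieties with complex multiplication by that field; `HC_CM` is neither used nor asserted — these are
«HC for NAMED classes» / «exceptional classes for NAMED classes» results.

THE HYPOTHESIS (IRR) for a CM field `K` (`ρ` = complex conjugation acting on `X = Hom(K, ℂ)`, `Anti` = the `ρ`-odd
rational weights `f(x̄) = −f(x)`, a rational `Aut(ℂ)`-module of dimension `n = [K:ℚ]/2`):

  every non-zero `Aut(ℂ)`-stable subspace of `Anti` is `Anti`

— `Anti` is IRREDUCIBLE over `ℚ`, not necessarily absolutely irreducible.  Seat gen 54 proved (SC) ⟺ (M1) ⟹ (IRR)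
(`antiWeights_irreducible_of_stabConj` below; (SC) = self-conjugate stabiliser orbits, (M1) = multiplicity one); so the
CM fields fall into THREE classes — (SC) | (IRR) without (SC) | not (IRR) — and this file treats the middle one with the
first: under (IRR) the commutant `D = End_{Aut(ℂ)}(Anti)` is a division algebra of dimension `d`, `= 1` iff (SC).

* §1 `antiWeights_irreducible_of_stabConj` ((SC) ⟹ (IRR)), `not_multiplicityOne_of_not_stabConj` (off (SC) some
  odd-valued equivariant endomorphism of `ℚ^{Hom(K,ℂ)}` is not a multiple of `f ↦ f − f∘ρ`),
  **`isNondegenerate_of_irreducible`** (EVERY CM type of an (IRR) field is nondegenerate: `dim MT(A_Φ) = dim A_Φ + 1`,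
  `B• = D•` on all powers), `isPrimitive_of_irreducible`, **`isSimple_of_irreducible`** (every abelian variety with CM by
  `K` is simple).
* §2 **`isNondegenerateFamily_iff_forall_equivariant_of_irreducible`** — a family `(Φ_i)` of CM types of an (IRR) field
  is nondegenerate (`Hg(∏ A_{Φ_i}) = ∏ Hg(A_{Φ_i})`) IFF its type vectors `u_i = 𝟙_{Φ_i} − 𝟙_{Φ̄_i}` satisfy NO
  EQUIVARIANT RELATION `Σ_i φ_i(u_i) = 0`, `φ_i(u_i) ≠ 0` (`φ_i` `Aut(ℂ)`-equivariant endomorphisms of `ℚ^{Hom(K,ℂ)}`);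
  **`isNondegenerateFamily_iff_not_exists_equivariant_of_irreducible`** — TWO types: IFF no equivariant `L` carries
  `u_{i₁}` to `u_{i₀}` (under (SC): `Φ_{i₁} ∉ {Φ_{i₀}, Φ̄_{i₀}}`; in general `u_{i₀} ∉ D·u_{i₁}`);
  **`two_mul_card_le_of_irreducible_of_not_stabConj`** — (IRR) WITHOUT (SC): a nondegenerate family has AT MOST `[K:ℚ]/4`
  members (`d ≥ 2`), against `[K:ℚ]/2` under (SC) (gen 54: ≤ 3 pairwise non-isogenous always nondegenerate).
* §3 varieties: `hodgeConjectureFor_prod_of_irreducible_of_forall_equivariant` / `…_of_not_exists_equivariant` (the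
  Hodge conjecture with `B• = D•` on every `⨁_{j<N} A_{π j}`, UNCONDITIONALLY, when the criterion holds),
  `forall_prod_hodgeClassSpan_eq_iff_of_irreducible` / `…_pair_…` (pairwise non-isogenous realisations — automatically
  simple: `B• = D•` on all products IFF the criterion), and **`exists_exceptional_prod_of_irreducible_of_not_stabConj`**:
  MORE THAN `[K:ℚ]/4` pairwise non-isogenous abelian varieties with CM by an (IRR) field that is NOT (SC) carry an
  exceptional Hodge class on some product (e.g. any THREE simple CM abelian fourfolds with CM by one octic such field;
  numerics, gen 54 census: the 8 octic Galois types of closure order 8, 8, 16, 16, 16, 16, 24 = `SL₂(𝔽₃)`, 32).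

## References

* [Serre1977] J.-P. Serre, *Linear Representations of Finite Groups*, GTM 42 (1977), §2.2 Prop. 4, §12.1–12.2.
* [Mai1989] L. Mai, *Lower bounds for the ranks of CM types*, J. Number Theory 32 (1989), §2 Prop. 1 (proof).
* [Kubota1965] T. Kubota, *On the field extension by complex multiplication*, Trans. AMS 118 (1965), §2 Lemma 2.
* [Shimura1998] G. Shimura, *Abelian Varieties with Complex Multiplication and Modular Functions*, §8.2 Prop. 26.
* [Gordon1999HodgeAVSurvey] B. B. Gordon, *A survey of the Hodge conjecture for abelian varieties*, §3, 7.5–7.7, 10.10.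
* [Wielandt1964] H. Wielandt, *Finite Permutation Groups* (1964), Thm. 28.4.
-/

set_option autoImplicit false

noncomputable section

open CategoryTheory CategoryTheory.Limits NumberField

namespace Summit.HodgeConjecture.CorCM

open Literature.NumberTheory.ComplexMultiplication
open Literature.AlgebraicGeometry.Motives (AbelianVariety CMType)
open Literature.AlgebraicGeometry.HodgeTheory
open Literature.AlgebraicGeometry.ComplexMultiplication (IsCMTypeRealisation isSimple_iff_isPrimitive)
open Literature.AlgebraicGeometry.VanGeemen1994 (hodgeClassSpan)
open Literature.AlgebraicGeometry.Pohlmann1968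
open Literature.Barriers.HodgeConjecture (divisorClassesSpan)
open GenericCMField

variable {K : Type} [Field K] [NumberField K] [IsCMField K]

/-! ## §1 (SC) ⟹ (IRR); off (SC) multiplicity one fails; every CM type of an (IRR) field is nondegenerate -/

section Types

/-- **(SC) ⟹ (IRR) for a CM field**: self-conjugate stabiliser orbits make the odd weights an irreducible
`Aut(ℂ)`-module (seat gen 54, `StabConj.antiWeights_irreducible_of_stabConj`, CM form).
[cite: Wielandt1964, Thm. 28.4] [cite: Serre1977, §2.2 Prop. 4] -/
theorem antiWeights_irreducible_of_stabConj
    (hSC : ∀ x₀ x : K →+* ℂ, x ≠ x₀ → x ≠ (starRingAut : ℂ ≃+* ℂ) • x₀ →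
      ∃ σ : ℂ ≃+* ℂ, σ • x₀ = x₀ ∧ σ • x = (starRingAut : ℂ ≃+* ℂ) • x)
    (W : Submodule ℚ ((K →+* ℂ) → ℚ)) (hW : W ≤ antiWeights (E := K →+* ℂ) (starRingAut : ℂ ≃+* ℂ))
    (hW0 : W ≠ ⊥) (hst : ∀ (k : ℂ ≃+* ℂ) (f : (K →+* ℂ) → ℚ), f ∈ W → (fun y => f (k • y)) ∈ W) :
    W = antiWeights (E := K →+* ℂ) (starRingAut : ℂ ≃+* ℂ) := by
  classical
  haveI := isPretransitive_ringEquiv_complex (K := K)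
  exact StabConj.antiWeights_irreducible_of_stabConj (G := ℂ ≃+* ℂ) conj_smul_conj_smul conj_smul_ne hSC W hW hW0 hst

omit [IsCMField K] in
/-- **(M1) ⟹ (IRR) for a CM field**: multiplicity one of the odd weights makes them irreducible.
[cite: Serre1977, §1.3 Thm. 1 and §2.2 Prop. 4] -/
theorem antiWeights_irreducible_of_multiplicityOne
    (hM1 : ∀ T : ((K →+* ℂ) → ℚ) →ₗ[ℚ] ((K →+* ℂ) → ℚ),
      (∀ (g : ℂ ≃+* ℂ) (f : (K →+* ℂ) → ℚ), T (fun x => f (g⁻¹ • x)) = fun x => T f (g⁻¹ • x)) →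
      (∀ (f : (K →+* ℂ) → ℚ) (x : K →+* ℂ), T f ((starRingAut : ℂ ≃+* ℂ) • x) = -T f x) →
      ∃ c : ℚ, ∀ f, T f = c • fun x => f x - f ((starRingAut : ℂ ≃+* ℂ) • x))
    (W : Submodule ℚ ((K →+* ℂ) → ℚ)) (hW : W ≤ antiWeights (E := K →+* ℂ) (starRingAut : ℂ ≃+* ℂ))
    (hW0 : W ≠ ⊥) (hst : ∀ (k : ℂ ≃+* ℂ) (f : (K →+* ℂ) → ℚ), f ∈ W → (fun y => f (k • y)) ∈ W) :
    W = antiWeights (E := K →+* ℂ) (starRingAut : ℂ ≃+* ℂ) := by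
  classical
  exact IrrOdd.antiWeights_irreducible_of_multiplicityOne (G := ℂ ≃+* ℂ) conj_smul_conj_smul hM1 W hW hW0 hst

/-- **Off (SC), multiplicity one fails**: if some `x ∉ {x₀, x̄₀}` is conjugated by no automorphism fixing `x₀`, then
some `Aut(ℂ)`-equivariant odd-valued endomorphism of `ℚ^{Hom(K,ℂ)}` is NOT a multiple of `f ↦ f − f∘ρ` (the orbital
kernel of `(x₀, x)`; contrapositive of gen 54 `StabConj.stabConj_of_multiplicityOne`). [cite: Wielandt1964, Thm. 28.4] -/
theorem not_multiplicityOne_of_not_stabConj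
    (hnSC : ¬ ∀ x₀ x : K →+* ℂ, x ≠ x₀ → x ≠ (starRingAut : ℂ ≃+* ℂ) • x₀ →
      ∃ σ : ℂ ≃+* ℂ, σ • x₀ = x₀ ∧ σ • x = (starRingAut : ℂ ≃+* ℂ) • x) :
    ¬ ∀ T : ((K →+* ℂ) → ℚ) →ₗ[ℚ] ((K →+* ℂ) → ℚ),
      (∀ (g : ℂ ≃+* ℂ) (f : (K →+* ℂ) → ℚ), T (fun x => f (g⁻¹ • x)) = fun x => T f (g⁻¹ • x)) →
      (∀ (f : (K →+* ℂ) → ℚ) (x : K →+* ℂ), T f ((starRingAut : ℂ ≃+* ℂ) • x) = -T f x) →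
      ∃ c : ℚ, ∀ f, T f = c • fun x => f x - f ((starRingAut : ℂ ≃+* ℂ) • x) := fun hM1 => by
  classical
  exact hnSC (StabConj.stabConj_of_multiplicityOne (G := ℂ ≃+* ℂ) smul_conj_smul conj_smul_conj_smul hM1)

/-- **EVERY CM TYPE OF AN (IRR) FIELD IS NONDEGENERATE**: `rank(Φ) = [K:ℚ]/2 + 1` (`dim MT(A_Φ) = dim A_Φ + 1`;
`B• = D•` on all powers of `A_Φ`, the Hodge conjecture for everything isogenous to a power).
[cite: Kubota1965, §2 Lemma 2] [cite: Mai1989, §2 Prop. 1 (proof)] -/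
theorem isNondegenerate_of_irreducible
    (hirr : ∀ W : Submodule ℚ ((K →+* ℂ) → ℚ), W ≤ antiWeights (E := K →+* ℂ) (starRingAut : ℂ ≃+* ℂ) → W ≠ ⊥ →
      (∀ (k : ℂ ≃+* ℂ) (f : (K →+* ℂ) → ℚ), f ∈ W → (fun y => f (k • y)) ∈ W) →
      W = antiWeights (E := K →+* ℂ) (starRingAut : ℂ ≃+* ℂ))
    (Φ : CMType K) : IsNondegenerate Φ := by
  classical
  rw [isNondegenerate_iff, cmTypeRank, ← Embeddings.card K ℂ]
  exact IrrOdd.typeRank_eq_of_irreducible (isCMTypeWith_conj Φ) hirr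

/-- **Every CM type of an (IRR) field is primitive** (nondegenerate ⟹ primitive). [cite: Shimura1998, §8.2 Prop. 26] -/
theorem isPrimitive_of_irreducible
    (hirr : ∀ W : Submodule ℚ ((K →+* ℂ) → ℚ), W ≤ antiWeights (E := K →+* ℂ) (starRingAut : ℂ ≃+* ℂ) → W ≠ ⊥ →
      (∀ (k : ℂ ≃+* ℂ) (f : (K →+* ℂ) → ℚ), f ∈ W → (fun y => f (k • y)) ∈ W) →
      W = antiWeights (E := K →+* ℂ) (starRingAut : ℂ ≃+* ℂ))
    (Φ : CMType K) (s₀ : K →+* ℂ) : IsPrimitive (ℂ ≃+* ℂ) Φ.1 s₀ :=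
  (isNondegenerate_of_irreducible hirr Φ).isPrimitive s₀

/-- **Every abelian variety with complex multiplication by an (IRR) field is simple.** [cite: Shimura1998, §8.2 Prop. 26] -/
theorem isSimple_of_irreducible
    (hirr : ∀ W : Submodule ℚ ((K →+* ℂ) → ℚ), W ≤ antiWeights (E := K →+* ℂ) (starRingAut : ℂ ≃+* ℂ) → W ≠ ⊥ →
      (∀ (k : ℂ ≃+* ℂ) (f : (K →+* ℂ) → ℚ), f ∈ W → (fun y => f (k • y)) ∈ W) →
      W = antiWeights (E := K →+* ℂ) (starRingAut : ℂ ≃+* ℂ))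
    {Φ : CMType K} {A : AbelianVariety ℂ} {ι : 𝓞 K →+* End A} {θ : K →+* Module.End ℂ (complexBetti A.X 1)}
    (hA : IsCMTypeRealisation Φ A ι θ) : A.IsSimple := by
  obtain ⟨s₀⟩ : Nonempty (K →+* ℂ) := inferInstance
  exact (isSimple_iff_isPrimitive hA s₀).2 (isPrimitive_of_irreducible hirr Φ s₀)

end Types

/-! ## §2 Families of types of one (IRR) field -/

section Families

variable {I : Type} [Fintype I] [DecidableEq I]

/-- **For an (IRR) field, a family of CM types is nondegenerate ⟺ its type vectors satisfy no equivariant relation**: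
`Hg(∏ A_{Φ_i}) = ∏ Hg(A_{Φ_i})` iff for all `Aut(ℂ)`-equivariant endomorphisms `φ_i` of `ℚ^{Hom(K,ℂ)}`,
`Σ_i φ_i(u_{Φ_i}) = 0 ⟹ ∀ i, φ_i(u_{Φ_i}) = 0` (`u_Φ = 𝟙_Φ − 𝟙_{Φ̄}`).  Under (SC) the `φ_i` are scalars on `Anti`
and this is linear independence (gen 54); in general it is independence over the commutant `D`.
[cite: Mai1989, §2 Prop. 1 (proof)] [cite: Gordon1999HodgeAVSurvey, 7.5–7.7] -/
theorem isNondegenerateFamily_iff_forall_equivariant_of_irreducible [Nonempty I]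
    (hirr : ∀ W : Submodule ℚ ((K →+* ℂ) → ℚ), W ≤ antiWeights (E := K →+* ℂ) (starRingAut : ℂ ≃+* ℂ) → W ≠ ⊥ →
      (∀ (k : ℂ ≃+* ℂ) (f : (K →+* ℂ) → ℚ), f ∈ W → (fun y => f (k • y)) ∈ W) →
      W = antiWeights (E := K →+* ℂ) (starRingAut : ℂ ≃+* ℂ))
    (Φ : I → CMType K) :
    CMAlgebra.IsNondegenerateFamily (K := fun _ : I => K) Φ ↔
      ∀ φ : I → (((K →+* ℂ) → ℚ) →ₗ[ℚ] ((K →+* ℂ) → ℚ)),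
        (∀ i (g : ℂ ≃+* ℂ) (f : (K →+* ℂ) → ℚ), φ i (fun x => f (g⁻¹ • x)) = fun x => φ i f (g⁻¹ • x)) →
        ∑ i, φ i (antiVec (Φ i).1 (1 : ℂ ≃+* ℂ)) = 0 → ∀ i, φ i (antiVec (Φ i).1 (1 : ℂ ≃+* ℂ)) = 0 := by
  rw [isNondegenerateFamily_iff_typeRank_sigmaType_eq]
  exact IrrOdd.typeRank_sigmaType_eq_iff_forall_equivariant (fun i => (Φ i).1) (fun i => isCMTypeWith_conj (Φ i)) hirr

variable {i₀ i₁ : I}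

/-- **TWO CM types of an (IRR) field: nondegenerate pair ⟺ no `Aut(ℂ)`-equivariant endomorphism of `ℚ^{Hom(K,ℂ)}`
carries `u_{Φ_{i₁}}` to `u_{Φ_{i₀}}`** (`Hg(A₀ × A₁) = Hg(A₀) × Hg(A₁)` ⟺ `u_{i₀} ∉ D·u_{i₁}`; under (SC):
⟺ `Φ_{i₁} ∉ {Φ_{i₀}, Φ̄_{i₀}}`). [cite: Gordon1999HodgeAVSurvey, §3 Theorem (proof) and 7.5–7.7] [cite: Serre1977, §2.2 Prop. 4] -/
theorem isNondegenerateFamily_iff_not_exists_equivariant_of_irreducible (hI : ∀ i, i = i₀ ∨ i = i₁) (h01 : i₀ ≠ i₁)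
    (hirr : ∀ W : Submodule ℚ ((K →+* ℂ) → ℚ), W ≤ antiWeights (E := K →+* ℂ) (starRingAut : ℂ ≃+* ℂ) → W ≠ ⊥ →
      (∀ (k : ℂ ≃+* ℂ) (f : (K →+* ℂ) → ℚ), f ∈ W → (fun y => f (k • y)) ∈ W) →
      W = antiWeights (E := K →+* ℂ) (starRingAut : ℂ ≃+* ℂ))
    (Φ : I → CMType K) :
    CMAlgebra.IsNondegenerateFamily (K := fun _ : I => K) Φ ↔
      ¬ ∃ L : ((K →+* ℂ) → ℚ) →ₗ[ℚ] ((K →+* ℂ) → ℚ),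
        (∀ (g : ℂ ≃+* ℂ) (f : (K →+* ℂ) → ℚ), L (fun y => f (g • y)) = fun x => L f (g • x)) ∧
        L (antiVec (Φ i₁).1 (1 : ℂ ≃+* ℂ)) = antiVec (Φ i₀).1 (1 : ℂ ≃+* ℂ) := by
  rw [isNondegenerateFamily_iff_typeRank_sigmaType_eq]
  exact IrrOdd.typeRank_sigmaType_eq_iff_not_exists_equivariant hI h01 (fun i => (Φ i).1)
    (fun i => isCMTypeWith_conj (Φ i)) hirr

/-- **Capacity with `d` commutant directions**: if `T_1, …, T_d` are `Aut(ℂ)`-equivariant odd-valued endomorphisms of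
`ℚ^{Hom(K,ℂ)}`, linearly independent on `Anti`, a nondegenerate family of CM types of the (IRR) field has
`|I| · d ≤ [K:ℚ]/2`. [cite: Mai1989, §2 Prop. 1 (proof)] [cite: Serre1977, §2.2 Prop. 4 and §12.2] -/
theorem card_mul_le_of_irreducible [Nonempty I]
    (hirr : ∀ W : Submodule ℚ ((K →+* ℂ) → ℚ), W ≤ antiWeights (E := K →+* ℂ) (starRingAut : ℂ ≃+* ℂ) → W ≠ ⊥ →
      (∀ (k : ℂ ≃+* ℂ) (f : (K →+* ℂ) → ℚ), f ∈ W → (fun y => f (k • y)) ∈ W) →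
      W = antiWeights (E := K →+* ℂ) (starRingAut : ℂ ≃+* ℂ))
    {Φ : I → CMType K} (hΦ : CMAlgebra.IsNondegenerateFamily (K := fun _ : I => K) Φ)
    {d : ℕ} (T : Fin d → (((K →+* ℂ) → ℚ) →ₗ[ℚ] ((K →+* ℂ) → ℚ)))
    (hT : ∀ j (g : ℂ ≃+* ℂ) (f : (K →+* ℂ) → ℚ), T j (fun x => f (g⁻¹ • x)) = fun x => T j f (g⁻¹ • x))
    (hTodd : ∀ j (f : (K →+* ℂ) → ℚ) (x : K →+* ℂ), T j f ((starRingAut : ℂ ≃+* ℂ) • x) = -T j f x)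
    (hTli : ∀ c : Fin d → ℚ,
      (∀ a ∈ antiWeights (E := K →+* ℂ) (starRingAut : ℂ ≃+* ℂ), ∑ j, c j • T j a = 0) → ∀ j, c j = 0) :
    Fintype.card I * d ≤ Module.finrank ℚ K / 2 := by
  rw [isNondegenerateFamily_iff_typeRank_sigmaType_eq] at hΦ
  rw [← Embeddings.card K ℂ]
  exact IrrOdd.card_mul_le_of_irreducible (fun i => (Φ i).1) (fun i => isCMTypeWith_conj (Φ i)) hirr hΦ T hT hTodd
    hTli

/-- **(IRR) WITHOUT (SC): a nondegenerate family of CM types has at most `[K:ℚ]/4` members** (`2|I| ≤ [K:ℚ]/2`): off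
(SC) the commutant of `Anti` has dimension `d ≥ 2`.  Compare (SC): at most `[K:ℚ]/2`, and any `≤ 3` pairwise
non-isogenous varieties nondegenerate (gen 54). [cite: Serre1977, §2.2 Prop. 4 and §12.2] [cite: Gordon1999HodgeAVSurvey, 7.7] -/
theorem two_mul_card_le_of_irreducible_of_not_stabConj [Nonempty I]
    (hirr : ∀ W : Submodule ℚ ((K →+* ℂ) → ℚ), W ≤ antiWeights (E := K →+* ℂ) (starRingAut : ℂ ≃+* ℂ) → W ≠ ⊥ →
      (∀ (k : ℂ ≃+* ℂ) (f : (K →+* ℂ) → ℚ), f ∈ W → (fun y => f (k • y)) ∈ W) →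
      W = antiWeights (E := K →+* ℂ) (starRingAut : ℂ ≃+* ℂ))
    (hnSC : ¬ ∀ x₀ x : K →+* ℂ, x ≠ x₀ → x ≠ (starRingAut : ℂ ≃+* ℂ) • x₀ →
      ∃ σ : ℂ ≃+* ℂ, σ • x₀ = x₀ ∧ σ • x = (starRingAut : ℂ ≃+* ℂ) • x)
    {Φ : I → CMType K} (hΦ : CMAlgebra.IsNondegenerateFamily (K := fun _ : I => K) Φ) :
    2 * Fintype.card I ≤ Module.finrank ℚ K / 2 := by
  rw [isNondegenerateFamily_iff_typeRank_sigmaType_eq] at hΦ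
  rw [← Embeddings.card K ℂ]
  exact IrrOdd.two_mul_card_le_of_irreducible_of_not_multiplicityOne (fun i => (Φ i).1)
    (fun i => isCMTypeWith_conj (Φ i)) hirr (not_multiplicityOne_of_not_stabConj hnSC) hΦ

/-- … equivalently **at most `[K:ℚ]/4` members**. [cite: Serre1977, §2.2 Prop. 4 and §12.2] [cite: Gordon1999HodgeAVSurvey, 7.7] -/
theorem card_le_finrank_div_four_of_irreducible_of_not_stabConj [Nonempty I]
    (hirr : ∀ W : Submodule ℚ ((K →+* ℂ) → ℚ), W ≤ antiWeights (E := K →+* ℂ) (starRingAut : ℂ ≃+* ℂ) → W ≠ ⊥ →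
      (∀ (k : ℂ ≃+* ℂ) (f : (K →+* ℂ) → ℚ), f ∈ W → (fun y => f (k • y)) ∈ W) →
      W = antiWeights (E := K →+* ℂ) (starRingAut : ℂ ≃+* ℂ))
    (hnSC : ¬ ∀ x₀ x : K →+* ℂ, x ≠ x₀ → x ≠ (starRingAut : ℂ ≃+* ℂ) • x₀ →
      ∃ σ : ℂ ≃+* ℂ, σ • x₀ = x₀ ∧ σ • x = (starRingAut : ℂ ≃+* ℂ) • x)
    {Φ : I → CMType K} (hΦ : CMAlgebra.IsNondegenerateFamily (K := fun _ : I => K) Φ) :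
    Fintype.card I ≤ Module.finrank ℚ K / 4 := by
  have h := two_mul_card_le_of_irreducible_of_not_stabConj hirr hnSC hΦ
  omega

end Families

/-! ## §3 Abelian varieties with complex multiplication by one (IRR) field -/

section Varieties

variable {I : Type} [Fintype I] [DecidableEq I] [Nonempty I] {Φ : I → CMType K} {A : I → AbelianVariety ℂ}
  {ι : ∀ i, 𝓞 K →+* End (A i)} {θ : ∀ i, K →+* Module.End ℂ (complexBetti (A i).X 1)} {i₀ i₁ : I}

/-- **The Hodge conjecture on every product `⨁_{j<N} A_{π j}` of abelian varieties with CM by one (IRR) field whose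
types satisfy no equivariant relation**, with `B• = D•` there — UNCONDITIONALLY. [cite: Gordon1999HodgeAVSurvey, 7.5 and 10.10] -/
theorem hodgeConjectureFor_prod_of_irreducible_of_forall_equivariant
    (hirr : ∀ W : Submodule ℚ ((K →+* ℂ) → ℚ), W ≤ antiWeights (E := K →+* ℂ) (starRingAut : ℂ ≃+* ℂ) → W ≠ ⊥ →
      (∀ (k : ℂ ≃+* ℂ) (f : (K →+* ℂ) → ℚ), f ∈ W → (fun y => f (k • y)) ∈ W) →
      W = antiWeights (E := K →+* ℂ) (starRingAut : ℂ ≃+* ℂ))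
    (hind : ∀ φ : I → (((K →+* ℂ) → ℚ) →ₗ[ℚ] ((K →+* ℂ) → ℚ)),
      (∀ i (g : ℂ ≃+* ℂ) (f : (K →+* ℂ) → ℚ), φ i (fun x => f (g⁻¹ • x)) = fun x => φ i f (g⁻¹ • x)) →
      ∑ i, φ i (antiVec (Φ i).1 (1 : ℂ ≃+* ℂ)) = 0 → ∀ i, φ i (antiVec (Φ i).1 (1 : ℂ ≃+* ℂ)) = 0)
    (hA : ∀ i, IsCMTypeRealisation (Φ i) (A i) (ι i) (θ i)) {N : ℕ} (π : Fin N → I) :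
    HodgeConjectureFor (⨁ fun j : Fin N => A (π j)).dim (⨁ fun j : Fin N => A (π j)).X ∧
      ∀ m : ℕ, hodgeClassSpan (⨁ fun j : Fin N => A (π j)).dim (⨁ fun j : Fin N => A (π j)).X m =
        divisorClassesSpan (⨁ fun j : Fin N => A (π j)).X (⨁ fun j : Fin N => A (π j)).dim m :=
  have h := (isNondegenerateFamily_iff_forall_equivariant_of_irreducible hirr Φ).2 hind
  ⟨h.hodgeConjectureFor_prod (K := fun _ : I => K) hA π,
    fun m => h.hodgeClassSpan_prod_eq_divisorClassesSpan (K := fun _ : I => K) hA π m⟩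

/-- **The Hodge conjecture on every `A₀^a × A₁^b`** (every `⨁_{j<N} A_{π j}`, `I = {i₀, i₁}`) for two abelian varieties
with CM by one (IRR) field such that no equivariant endomorphism carries `u_{Φ_{i₁}}` to `u_{Φ_{i₀}}`, with `B• = D•` —
UNCONDITIONALLY. [cite: Gordon1999HodgeAVSurvey, 7.5 and 10.10] -/
theorem hodgeConjectureFor_prod_of_irreducible_of_not_exists_equivariant (hI : ∀ i, i = i₀ ∨ i = i₁) (h01 : i₀ ≠ i₁)
    (hirr : ∀ W : Submodule ℚ ((K →+* ℂ) → ℚ), W ≤ antiWeights (E := K →+* ℂ) (starRingAut : ℂ ≃+* ℂ) → W ≠ ⊥ →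
      (∀ (k : ℂ ≃+* ℂ) (f : (K →+* ℂ) → ℚ), f ∈ W → (fun y => f (k • y)) ∈ W) →
      W = antiWeights (E := K →+* ℂ) (starRingAut : ℂ ≃+* ℂ))
    (hno : ¬ ∃ L : ((K →+* ℂ) → ℚ) →ₗ[ℚ] ((K →+* ℂ) → ℚ),
      (∀ (g : ℂ ≃+* ℂ) (f : (K →+* ℂ) → ℚ), L (fun y => f (g • y)) = fun x => L f (g • x)) ∧
      L (antiVec (Φ i₁).1 (1 : ℂ ≃+* ℂ)) = antiVec (Φ i₀).1 (1 : ℂ ≃+* ℂ))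
    (hA : ∀ i, IsCMTypeRealisation (Φ i) (A i) (ι i) (θ i)) {N : ℕ} (π : Fin N → I) :
    HodgeConjectureFor (⨁ fun j : Fin N => A (π j)).dim (⨁ fun j : Fin N => A (π j)).X ∧
      ∀ m : ℕ, hodgeClassSpan (⨁ fun j : Fin N => A (π j)).dim (⨁ fun j : Fin N => A (π j)).X m =
        divisorClassesSpan (⨁ fun j : Fin N => A (π j)).X (⨁ fun j : Fin N => A (π j)).dim m :=
  have h := (isNondegenerateFamily_iff_not_exists_equivariant_of_irreducible hI h01 hirr Φ).2 hno
  ⟨h.hodgeConjectureFor_prod (K := fun _ : I => K) hA π,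
    fun m => h.hodgeClassSpan_prod_eq_divisorClassesSpan (K := fun _ : I => K) hA π m⟩

/-- **PAIRWISE NON-ISOGENOUS abelian varieties with CM by one (IRR) field (automatically simple): `B• = D•` on ALL
their products `⨁_{j<N} A_{π j}` IFF their type vectors satisfy no equivariant relation** — otherwise some product carries
an exceptional Hodge class. [cite: Gordon1999HodgeAVSurvey, 7.5–7.7] -/
theorem forall_prod_hodgeClassSpan_eq_iff_of_irreducible
    (hirr : ∀ W : Submodule ℚ ((K →+* ℂ) → ℚ), W ≤ antiWeights (E := K →+* ℂ) (starRingAut : ℂ ≃+* ℂ) → W ≠ ⊥ →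
      (∀ (k : ℂ ≃+* ℂ) (f : (K →+* ℂ) → ℚ), f ∈ W → (fun y => f (k • y)) ∈ W) →
      W = antiWeights (E := K →+* ℂ) (starRingAut : ℂ ≃+* ℂ))
    (hA : ∀ i, IsCMTypeRealisation (Φ i) (A i) (ι i) (θ i))
    (hniso : ∀ i i', i ≠ i' → ¬ AbelianVariety.IsIsogenous (A i) (A i')) :
    (∀ (N : ℕ) (π : Fin N → I) (m : ℕ),
      hodgeClassSpan (⨁ fun j : Fin N => A (π j)).dim (⨁ fun j : Fin N => A (π j)).X m =
        divisorClassesSpan (⨁ fun j : Fin N => A (π j)).X (⨁ fun j : Fin N => A (π j)).dim m) ↔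
      ∀ φ : I → (((K →+* ℂ) → ℚ) →ₗ[ℚ] ((K →+* ℂ) → ℚ)),
        (∀ i (g : ℂ ≃+* ℂ) (f : (K →+* ℂ) → ℚ), φ i (fun x => f (g⁻¹ • x)) = fun x => φ i f (g⁻¹ • x)) →
        ∑ i, φ i (antiVec (Φ i).1 (1 : ℂ ≃+* ℂ)) = 0 → ∀ i, φ i (antiVec (Φ i).1 (1 : ℂ ≃+* ℂ)) = 0 := by
  rw [← CMAlgebra.isNondegenerateFamily_iff_forall_prod_hodgeClassSpan_eq (K := fun _ : I => K)
    (CMAlgebra.isSeparatingFamily_of_isSimple_of_pairwise_not_isIsogenous hA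
      (fun i => isSimple_of_irreducible hirr (hA i)) hniso) hA]
  exact isNondegenerateFamily_iff_forall_equivariant_of_irreducible hirr Φ

/-- **Two NON-ISOGENOUS abelian varieties with CM by one (IRR) field: `B• = D•` on all `A₀^a × A₁^b` IFF no
equivariant endomorphism carries `u_{Φ_{i₁}}` to `u_{Φ_{i₀}}`** — otherwise some `A₀^a × A₁^b` carries an exceptional Hodge
class. [cite: Gordon1999HodgeAVSurvey, 7.5–7.7] -/
theorem forall_prod_hodgeClassSpan_eq_iff_pair_of_irreducible (hI : ∀ i, i = i₀ ∨ i = i₁) (h01 : i₀ ≠ i₁)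
    (hirr : ∀ W : Submodule ℚ ((K →+* ℂ) → ℚ), W ≤ antiWeights (E := K →+* ℂ) (starRingAut : ℂ ≃+* ℂ) → W ≠ ⊥ →
      (∀ (k : ℂ ≃+* ℂ) (f : (K →+* ℂ) → ℚ), f ∈ W → (fun y => f (k • y)) ∈ W) →
      W = antiWeights (E := K →+* ℂ) (starRingAut : ℂ ≃+* ℂ))
    (hA : ∀ i, IsCMTypeRealisation (Φ i) (A i) (ι i) (θ i))
    (hniso : ∀ i i', i ≠ i' → ¬ AbelianVariety.IsIsogenous (A i) (A i')) :
    (∀ (N : ℕ) (π : Fin N → I) (m : ℕ),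
      hodgeClassSpan (⨁ fun j : Fin N => A (π j)).dim (⨁ fun j : Fin N => A (π j)).X m =
        divisorClassesSpan (⨁ fun j : Fin N => A (π j)).X (⨁ fun j : Fin N => A (π j)).dim m) ↔
      ¬ ∃ L : ((K →+* ℂ) → ℚ) →ₗ[ℚ] ((K →+* ℂ) → ℚ),
        (∀ (g : ℂ ≃+* ℂ) (f : (K →+* ℂ) → ℚ), L (fun y => f (g • y)) = fun x => L f (g • x)) ∧
        L (antiVec (Φ i₁).1 (1 : ℂ ≃+* ℂ)) = antiVec (Φ i₀).1 (1 : ℂ ≃+* ℂ) := by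
  rw [← CMAlgebra.isNondegenerateFamily_iff_forall_prod_hodgeClassSpan_eq (K := fun _ : I => K)
    (CMAlgebra.isSeparatingFamily_of_isSimple_of_pairwise_not_isIsogenous hA
      (fun i => isSimple_of_irreducible hirr (hA i)) hniso) hA]
  exact isNondegenerateFamily_iff_not_exists_equivariant_of_irreducible hI h01 hirr Φ

/-- **MORE THAN `[K:ℚ]/4` PAIRWISE NON-ISOGENOUS ABELIAN VARIETIES WITH CM BY AN (IRR) FIELD THAT IS NOT (SC) CARRY AN
EXCEPTIONAL HODGE CLASS ON SOME PRODUCT `⨁_{j<N} A_{π j}`** — e.g. any three simple CM abelian fourfolds with CM by one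
octic CM field whose odd weights are irreducible but which is not (SC) (the family is separating — every member is
simple — but exceeds the capacity `[K:ℚ]/4`). [cite: Gordon1999HodgeAVSurvey, 7.6.1 and 7.7] [cite: Serre1977, §2.2 Prop. 4 and §12.2] -/
theorem exists_exceptional_prod_of_irreducible_of_not_stabConj
    (hirr : ∀ W : Submodule ℚ ((K →+* ℂ) → ℚ), W ≤ antiWeights (E := K →+* ℂ) (starRingAut : ℂ ≃+* ℂ) → W ≠ ⊥ →
      (∀ (k : ℂ ≃+* ℂ) (f : (K →+* ℂ) → ℚ), f ∈ W → (fun y => f (k • y)) ∈ W) →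
      W = antiWeights (E := K →+* ℂ) (starRingAut : ℂ ≃+* ℂ))
    (hnSC : ¬ ∀ x₀ x : K →+* ℂ, x ≠ x₀ → x ≠ (starRingAut : ℂ ≃+* ℂ) • x₀ →
      ∃ σ : ℂ ≃+* ℂ, σ • x₀ = x₀ ∧ σ • x = (starRingAut : ℂ ≃+* ℂ) • x)
    (hA : ∀ i, IsCMTypeRealisation (Φ i) (A i) (ι i) (θ i))
    (hniso : ∀ i j, i ≠ j → ¬AbelianVariety.IsIsogenous (A i) (A j))
    (hcard : Module.finrank ℚ K / 4 < Fintype.card I) :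
    ∃ (N : ℕ) (π : Fin N → I) (m : ℕ) (c : complexBetti (⨁ fun j : Fin N => A (π j)).X (2 * m)),
      IsRationalClass c ∧
      IsOfHodgeType (⨁ fun j : Fin N => A (π j)).dim (⨁ fun j : Fin N => A (π j)).X (2 * m) m m c ∧
      c ∉ divisorClassesSpan (⨁ fun j : Fin N => A (π j)).X (⨁ fun j : Fin N => A (π j)).dim m :=
  CMAlgebra.exists_exceptional_prod_of_not_isNondegenerateFamily (K := fun _ : I => K)
    (CMAlgebra.isSeparatingFamily_of_isSimple_of_pairwise_not_isIsogenous hA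
      (fun i => isSimple_of_irreducible hirr (hA i)) hniso)
    (fun hΦ => absurd (card_le_finrank_div_four_of_irreducible_of_not_stabConj hirr hnSC hΦ) (not_le.2 hcard)) hA

/-- **With `d` independent commutant directions: more than `[K:ℚ]/(2d)` pairwise non-isogenous varieties with CM by the
(IRR) field carry an exceptional Hodge class on some product.** [cite: Gordon1999HodgeAVSurvey, 7.6.1 and 7.7]
[cite: Serre1977, §2.2 Prop. 4 and §12.2] -/
theorem exists_exceptional_prod_of_irreducible_of_lt_card_mul
    (hirr : ∀ W : Submodule ℚ ((K →+* ℂ) → ℚ), W ≤ antiWeights (E := K →+* ℂ) (starRingAut : ℂ ≃+* ℂ) → W ≠ ⊥ →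
      (∀ (k : ℂ ≃+* ℂ) (f : (K →+* ℂ) → ℚ), f ∈ W → (fun y => f (k • y)) ∈ W) →
      W = antiWeights (E := K →+* ℂ) (starRingAut : ℂ ≃+* ℂ))
    {d : ℕ} (T : Fin d → (((K →+* ℂ) → ℚ) →ₗ[ℚ] ((K →+* ℂ) → ℚ)))
    (hT : ∀ j (g : ℂ ≃+* ℂ) (f : (K →+* ℂ) → ℚ), T j (fun x => f (g⁻¹ • x)) = fun x => T j f (g⁻¹ • x))
    (hTodd : ∀ j (f : (K →+* ℂ) → ℚ) (x : K →+* ℂ), T j f ((starRingAut : ℂ ≃+* ℂ) • x) = -T j f x)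
    (hTli : ∀ c : Fin d → ℚ,
      (∀ a ∈ antiWeights (E := K →+* ℂ) (starRingAut : ℂ ≃+* ℂ), ∑ j, c j • T j a = 0) → ∀ j, c j = 0)
    (hA : ∀ i, IsCMTypeRealisation (Φ i) (A i) (ι i) (θ i))
    (hniso : ∀ i j, i ≠ j → ¬AbelianVariety.IsIsogenous (A i) (A j))
    (hcard : Module.finrank ℚ K / 2 < Fintype.card I * d) :
    ∃ (N : ℕ) (π : Fin N → I) (m : ℕ) (c : complexBetti (⨁ fun j : Fin N => A (π j)).X (2 * m)),
      IsRationalClass c ∧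
      IsOfHodgeType (⨁ fun j : Fin N => A (π j)).dim (⨁ fun j : Fin N => A (π j)).X (2 * m) m m c ∧
      c ∉ divisorClassesSpan (⨁ fun j : Fin N => A (π j)).X (⨁ fun j : Fin N => A (π j)).dim m :=
  CMAlgebra.exists_exceptional_prod_of_not_isNondegenerateFamily (K := fun _ : I => K)
    (CMAlgebra.isSeparatingFamily_of_isSimple_of_pairwise_not_isIsogenous hA
      (fun i => isSimple_of_irreducible hirr (hA i)) hniso)
    (fun hΦ => absurd (card_mul_le_of_irreducible hirr hΦ T hT hTodd hTli) (not_le.2 hcard)) hA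

end Varieties

end Summit.HodgeConjecture.CorCM

end
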